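import Literature.Analysis.Fourier.StationaryPhase
import Literature.NumberTheory.LFunctions.AndersonStarkLiouvilleProofs
import HarnessLib

/-!
# The value of the Fresnel constant: `∫_{-∞}^{∞} e^{iu²/2} du = (2π)^{1/2} e^{iπ/4}`

Topic `Literature/Analysis/Fourier`. Everything in this file is PROVED (no definitions, no named
facts).

The tree's stationary-phase estimate `Literature.Analysis.Fourier.stationaryPhase` (Titchmarsh,
*The Theory of the Riemann Zeta-Function*, Lemma 4.6) is stated with the Fresnel constant
`𝔣 = Literature.Analysis.Fourier.fresnelC = 2 lim_{n → ∞} ∫_0^n e^{iu²/2} du`, whose value was left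
uncomputed in `StationaryPhase.lean` ("its value `(2π)^{1/2} e^{iπ/4}` is not needed for the
applications"). For the main terms of stationary-phase evaluations that are summed with other main
terms — Titchmarsh's Lemma 9.22 (`∫_T^{T+U} z₁(t)² (n/m)^{it} dt`, where `e^{-iπ/4} 𝔣 = (2π)^{1/2}`
produces the real main term `2π (m/n)^{1/2} ∑∑ e^{-2πi μν m/n}`) — the value *is* needed. It follows
at once from the tree's Fresnel evaluation
`Literature.NumberTheory.LFunctions.norm_integral_cexp_fresnel_sub_le`
(`‖∫_0^y e^{iπv²/2} dv − (1+i)/2‖ ≤ 2/(πy)`, proved in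
`Literature/NumberTheory/LFunctions/AndersonStarkLiouvilleProofs.lean` by Gaussian regularisation)
and the substitution `u = π^{1/2} v`:

* `Literature.Analysis.Fourier.fresnelS_eq_sqrt_pi_mul` — `∫_0^X e^{iu²/2} du = π^{1/2} ∫_0^{X/√π} e^{iπv²/2} dv`;
* `Literature.Analysis.Fourier.norm_fresnelS_sub_le` — `‖∫_0^X e^{iu²/2} du − π^{1/2}(1+i)/2‖ ≤ 2/X`;
* `Literature.Analysis.Fourier.fresnelLim_eq` — `lim ∫_0^n e^{iu²/2} du = π^{1/2} (1+i)/2`;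
* `Literature.Analysis.Fourier.fresnelC_eq_sqrt_pi_mul` — `𝔣 = π^{1/2} (1 + i)`;
* `Literature.Analysis.Fourier.fresnelC_eq` — **`𝔣 = (2π)^{1/2} e^{iπ/4}`**;
* `Literature.Analysis.Fourier.cexp_neg_mul_fresnelC`, `Literature.Analysis.Fourier.norm_fresnelC`,
  `Literature.Analysis.Fourier.fresnelC_sq` — `e^{-iπ/4} 𝔣 = (2π)^{1/2}`, `‖𝔣‖ = (2π)^{1/2}`,
  `𝔣² = 2πi`.

## References

* E. C. Titchmarsh, *The Theory of the Riemann Zeta-Function*, 2nd ed. (rev. D. R. Heath-Brown),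
  Oxford 1986, Lemma 4.6 ("`∫_{-∞}^{∞} e^{½iF''(c)u²} du = (2π/F''(c))^{1/2} e^{iπ/4}`") and §9.22.
  [cite: Titchmarsh1986, Lemma 4.6]
* R. J. Anderson, H. M. Stark, *Oscillation theorems*, LNM 899 (1981), §4 (17) (the Fresnel
  integrals `C(∞) = S(∞) = ½`).
-/

noncomputable section

open MeasureTheory Set intervalIntegral Complex Filter Topology
open scoped Real

namespace Literature.Analysis.Fourier

/-- **Substitution `u = π^{1/2} v`**: `∫_0^X e^{iu²/2} du = π^{1/2} ∫_0^{X/√π} e^{iπv²/2} dv`. [folklore] -/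
theorem fresnelS_eq_sqrt_pi_mul (X : ℝ) :
    fresnelS X = (Real.sqrt π : ℂ) * ∫ v in (0 : ℝ)..X / Real.sqrt π, cexp ((π * v ^ 2 / 2 : ℝ) * I) := by
  have hπ : 0 < Real.sqrt π := Real.sqrt_pos.2 Real.pi_pos
  have hsq : Real.sqrt π ^ 2 = π := Real.sq_sqrt Real.pi_pos.le
  have hf : ∀ v : ℝ, fresnelIntegrand (Real.sqrt π * v) = cexp ((π * v ^ 2 / 2 : ℝ) * I) := by
    intro v
    rw [fresnelIntegrand, mul_comm I]
    congr 2
    push_cast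
    rw [mul_pow]
    congr 1
    norm_cast
    rw [hsq]
  have h := intervalIntegral.smul_integral_comp_mul_left (f := fresnelIntegrand) (a := 0)
    (b := X / Real.sqrt π) (Real.sqrt π)
  rw [mul_zero, mul_div_cancel₀ X hπ.ne'] at h
  rw [fresnelS, ← h, Complex.real_smul]
  congr 1
  exact intervalIntegral.integral_congr fun v _ => hf v

/-- **`‖∫_0^X e^{iu²/2} du − π^{1/2}(1+i)/2‖ ≤ 2/X`** for `X > 0`. [cite: Titchmarsh1986, Lemma 4.6] -/
theorem norm_fresnelS_sub_le {X : ℝ} (hX : 0 < X) :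
    ‖fresnelS X - (Real.sqrt π : ℂ) * ((1 + I) / 2)‖ ≤ 2 / X := by
  have hπ : 0 < Real.sqrt π := Real.sqrt_pos.2 Real.pi_pos
  have hsq : Real.sqrt π * Real.sqrt π = π := Real.mul_self_sqrt Real.pi_pos.le
  have hy : 0 < X / Real.sqrt π := div_pos hX hπ
  have h := Literature.NumberTheory.LFunctions.norm_integral_cexp_fresnel_sub_le hy
  rw [fresnelS_eq_sqrt_pi_mul, ← mul_sub, norm_mul, Complex.norm_real, Real.norm_eq_abs,
    abs_of_pos hπ]
  calc Real.sqrt π * ‖(∫ v in (0 : ℝ)..X / Real.sqrt π, cexp ((π * v ^ 2 / 2 : ℝ) * I)) - (1 + I) / 2‖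
      ≤ Real.sqrt π * (2 / (π * (X / Real.sqrt π))) := mul_le_mul_of_nonneg_left h hπ.le
    _ = 2 / X := by
        field_simp
        rw [sq, hsq]

/-- **`lim_{n→∞} ∫_0^n e^{iu²/2} du = π^{1/2} (1+i)/2`.** [cite: Titchmarsh1986, Lemma 4.6] -/
theorem fresnelLim_eq : fresnelLim = (Real.sqrt π : ℂ) * ((1 + I) / 2) := by
  refine tendsto_nhds_unique tendsto_fresnelS ?_
  rw [tendsto_iff_norm_sub_tendsto_zero]
  have hlim : Tendsto (fun n : ℕ => 2 / (n : ℝ)) atTop (𝓝 0) :=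
    tendsto_const_div_atTop_nhds_zero_nat 2
  refine squeeze_zero' (Eventually.of_forall fun n => norm_nonneg _) ?_ hlim
  filter_upwards [eventually_gt_atTop 0] with n hn
  exact norm_fresnelS_sub_le (by exact_mod_cast hn)

/-- **`𝔣 = π^{1/2} (1 + i)`.** [cite: Titchmarsh1986, Lemma 4.6] -/
theorem fresnelC_eq_sqrt_pi_mul : fresnelC = (Real.sqrt π : ℂ) * (1 + I) := by
  rw [fresnelC, fresnelLim_eq]
  ring

/-- **The Fresnel constant: `𝔣 = ∫_{-∞}^{∞} e^{iu²/2} du = (2π)^{1/2} e^{iπ/4}`.**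
[cite: Titchmarsh1986, Lemma 4.6] -/
theorem fresnelC_eq : fresnelC = (Real.sqrt (2 * π) : ℂ) * cexp ((π / 4 : ℝ) * I) := by
  rw [fresnelC_eq_sqrt_pi_mul, Complex.exp_mul_I]
  have hc : Complex.cos ((π / 4 : ℝ) : ℂ) = ((Real.sqrt 2 / 2 : ℝ) : ℂ) := by
    rw [← Complex.ofReal_cos, Real.cos_pi_div_four]
  have hs : Complex.sin ((π / 4 : ℝ) : ℂ) = ((Real.sqrt 2 / 2 : ℝ) : ℂ) := by
    rw [← Complex.ofReal_sin, Real.sin_pi_div_four]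
  rw [hc, hs]
  have h2π : Real.sqrt (2 * π) = Real.sqrt 2 * Real.sqrt π :=
    Real.sqrt_mul (by norm_num) π
  rw [h2π]
  push_cast
  have h2 : ((Real.sqrt 2 : ℝ) : ℂ) ^ 2 = 2 := by
    rw [← Complex.ofReal_pow, Real.sq_sqrt (by norm_num : (0:ℝ) ≤ 2)]; norm_num
  linear_combination (-(Real.sqrt π : ℂ) * (1 + I) / 2) * h2

/-- `e^{-iπ/4} 𝔣 = (2π)^{1/2}` (the combination appearing in Titchmarsh §9.22). [cite: Titchmarsh1986, §9.22] -/
theorem cexp_neg_mul_fresnelC :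
    cexp (-(π / 4 : ℝ) * I) * fresnelC = (Real.sqrt (2 * π) : ℂ) := by
  rw [fresnelC_eq, mul_left_comm, ← Complex.exp_add]
  have : -(π / 4 : ℝ) * I + (π / 4 : ℝ) * I = 0 := by ring
  rw [this, Complex.exp_zero, mul_one]

/-- `‖𝔣‖ = (2π)^{1/2}`. [cite: Titchmarsh1986, Lemma 4.6] -/
theorem norm_fresnelC : ‖fresnelC‖ = Real.sqrt (2 * π) := by
  rw [fresnelC_eq, norm_mul, Complex.norm_real, Complex.norm_exp_ofReal_mul_I, mul_one,
    Real.norm_eq_abs, abs_of_nonneg (Real.sqrt_nonneg _)]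

/-- `𝔣² = 2πi`. [cite: Titchmarsh1986, Lemma 4.6] -/
theorem fresnelC_sq : fresnelC ^ 2 = 2 * π * I := by
  rw [fresnelC_eq_sqrt_pi_mul, mul_pow]
  have h1 : ((Real.sqrt π : ℂ)) ^ 2 = (π : ℂ) := by
    rw [← Complex.ofReal_pow, Real.sq_sqrt Real.pi_pos.le]
  rw [h1]
  have hI : I ^ 2 = -1 := Complex.I_sq
  linear_combination (π : ℂ) * hI

end Literature.Analysis.Fourier
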